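import Summits.BirchSwinnertonDyer.Rank1Residual.Additive.QuadraticBranchPAdicGrossZagierValuation
import Summits.BirchSwinnertonDyer.Rank1Residual.Additive.StrictSelmerIndex
import HarnessLib

/-!
# The CONVERSE bookkeeping of p307042: at a pair where `BSD(W, p)` is already a theorem, the
# valuation content of C-cc-1 (`QuadraticBranchPAdicGrossZagierValuationAt`) FOLLOWS from (C3_η)
# (+ the discharged index) — so C-cc-1 and `BSD(W, p)` are the SAME open statement modulo
# (C1_η) ∧ (C3_η) (cell `bsd-cm`, seat `bsd-cm-inert` g0; PROVED arithmetic; nothing asserted)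

HONEST FRAMING (cell `bsd-cm`, run/shared/lean/pub/bsd-cm/): FULL BSD for every analytic-rank `≤ 1`
curve is the programme's target of record; this seat attacks the O10 first rung C-cc-1. This file
claims NOTHING new about any pair: it is the three-line converse of the PROVED consumer
`bsdp_of_quadraticBranchPAdicGrossZagierValuation_of_exactControl` (cc-typer-6 p307042 §4: (C1_η) ∧
(C2_η-GZ) ∧ (C3_η) ⟹ `BSDp W p`), recorded in the kernel because the seat's memo
(`HOME/MEMO-bsd-cm-inert.md` §2) rests an argument on it: **given the algebraic side (C3_η) at a pair
and Miller's `BSD(W, p)` at that pair, the valuation identity of C-cc-1 holds at that pair** — hence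
(i) C-cc-1 cannot be proved from main conjectures + control + Euler-system bounds alone (they never
see `L′(W,1)`; given them it IS `BSD(W,p)`), and (ii) on every pair where `BSD(W, p)` is decided per
pair (all O10 pairs `N < 5·10⁵`, x1b RULING a8bd8e04) the VALUATION content of the engine rows of
record is, modulo (C1_η), a consequence — what those rows test beyond it is the VALUE identity
(C2_η-VAL). No named fact; no `sorry`; net debt `0`; nothing booked; no label / mark / count moves;
C-cc-1 stays a typed CONJECTURE item (REF-1 of the cell referee pending).

Contents: `valuation_coeff_one_eq_of_bsdp_of_exactControl` (pointwise, data displayed);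
`quadraticBranchPAdicGrossZagierValuationAt_of_bsdp` (the typed item at `(W, p)` from `BSDp W p`,
(C3_η), (C1_η) on the twins, and the non-vanishing of `coeff₁` on the data — the last is implied on
paper by (C1_η) + the algebraic side in rank one, x1b `C3ETA-TRANSVERSALITY-x1b.md` §5(a), and is
kept displayed here).

References (locators only): [Miller2011LMS] §1, Def. 1.1; [Kobayashi2003] §4 p. 8, Thm. 7.4 p. 13,
Thm. 9.3 p. 26; [GreenbergLNM1716] §2 pp. 62–63.
-/

noncomputable section

open scoped Classical MatrixGroups ModularForm

open CongruenceSubgroup WeierstrassCurve Literature.NumberTheory.EllipticCurves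
  Literature.NumberTheory.EllipticCurves.ModularForms
  Literature.NumberTheory.EllipticCurves.Kobayashi2003
  Literature.NumberTheory.EllipticCurves.Rank1Residual
  Literature.NumberTheory.EllipticCurves.Rank1Residual.Typed

namespace Summit.BirchSwinnertonDyer.Rank1Residual.Additive

section Converse

variable (W : WeierstrassCurve ℚ) [W.IsElliptic] [W.IsGloballyMinimal] (p : ℕ) [Fact p.Prime]
  {V : WeierstrassCurve ℚ} [V.IsElliptic] [V.IsGloballyMinimal] {C : VariableChange ℚ}
  {N : ℕ} [NeZero N] {f : CuspForm (Gamma0 N) 2} {ϖ : ℚ} {L : IwasawaAlgebra p}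
  {P : W.toAffine.Point} {n : ℕ}

/-- **Converse bookkeeping (PROVED arithmetic): `BSD(W, p)` ∧ (C3_η) at the data ⟹ the valuation
identity of C-cc-1 at the data.** With `#Sel_str = pⁿ·#Ш[p^∞]` (the DISCHARGED index
`StrictSha.strictSelmerIndexAt_holds`), (C3_η) reads `v_p(coeff₁ L) = 2n + ord_p #Ш(W)[p^∞] +
ord_p(Tam/#tors²)`, and `BSD(W, p)` replaces `ord_p #Ш(W)[p^∞]` by `ord_p #Ш_an(W)`: for every
rational `q` with `#Ш_an(W) = q`, `v_p(coeff₁ L) = 2n + ord_p(q·Tam(W)/#W(ℚ)_tors²)`. CONDITIONAL on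
the displayed hypotheses; nothing booked. [cite: Miller2011LMS, §1 and Def. 1.1]
[cite: Kobayashi2003, §4 (p. 8), Thm. 7.4 (p. 13), Thm. 9.3 (p. 26)] [cite: GreenbergLNM1716, §2 (pp. 62–63)] -/
theorem valuation_coeff_one_eq_of_bsdp_of_exactControl (hmod : hasEntireLFunction_rat)
    (hB : BSDp W p) (h3 : QuadraticBranchOddStrictExactControlOfPlusMCAt W p)
    (hp : 5 ≤ p) (hC : C • W.quadraticTwist ((-1) ^ (p / 2) * p) = V)
    (hgood : V.HasGoodReductionAtPrime p) (hap : V.frobeniusTrace p = 0)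
    (h1 : QuadraticBranchPlusMainConjectureAt V p) (hf : IsNewformOf V f)
    (hϖ : if Even (p / 2) then (ϖ : ℝ) * V.realPeriodRat = plusPeriod f
        else (ϖ : ℝ) * V.imaginaryPeriodRat = minusPeriod f)
    (hL : IsQuadraticBranchMinusLFunction f p ϖ L)
    (htors : ∀ Q : (W.baseChange ℚ_[p]).toAffine.Point, p • Q = 0 → Q = 0)
    (hP : ¬ IsOfFinAddOrder P)
    (hgen : ∀ R : W.toAffine.Point, ∃ (k : ℤ) (T : W.toAffine.Point),
      IsOfFinAddOrder T ∧ R = k • P + T)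
    (hdiv : ∃ Q : (W.baseChange ℚ_[p]).toAffine.Point, p ^ n • Q = W.toPadicPoint p P)
    (hndiv : ∀ Q : (W.baseChange ℚ_[p]).toAffine.Point, p ^ (n + 1) • Q ≠ W.toPadicPoint p P)
    (hr : W.analyticRank = 1) (hne : PowerSeries.coeff 1 L ≠ 0)
    (q : ℚ) (hq : shaAn W = (q : ℂ)) :
    ((PowerSeries.coeff 1 L : ℤ_[p]) : ℚ_[p]).valuation =
      2 * (n : ℤ) + padicValRat p (q * W.tamagawaProduct / (W.torsionOrder : ℚ) ^ 2) := by
  obtain ⟨-, hfin, s, hs, hval⟩ := hB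
  haveI : Finite (AddCommGroup.primaryComponent W.sha p) := hfin
  -- `q = s`: both are `#Ш_an(W)`
  have hqs : q = s := by
    have : ((q : ℂ)) = (s : ℂ) := by rw [← hq, hs]
    exact_mod_cast this
  subst hqs
  have hq0 : q ≠ 0 := by
    rintro rfl
    exact AdditivePotMult.shaAn_ne_zero W hmod (by rw [hq, Rat.cast_zero])
  have hc : (W.tamagawaProduct : ℚ) ≠ 0 := by exact_mod_cast W.tamagawaProduct_pos_holds.ne'
  have ht : (W.torsionOrder : ℚ) ≠ 0 := by exact_mod_cast W.torsionOrder_pos_holds.ne'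
  have hct : (W.tamagawaProduct : ℚ) / (W.torsionOrder : ℚ) ^ 2 ≠ 0 :=
    div_ne_zero hc (pow_ne_zero 2 ht)
  have hsplit : padicValRat p (q * W.tamagawaProduct / (W.torsionOrder : ℚ) ^ 2) =
      padicValRat p q + padicValRat p ((W.tamagawaProduct : ℚ) / (W.torsionOrder : ℚ) ^ 2) := by
    rw [mul_div_assoc, padicValRat.mul hq0 hct]
  -- (C3_η) at the data
  obtain ⟨-, hv3⟩ := h3 V C hp hC hgood hap hr h1 hf ϖ hϖ L hL htors P n hP hgen hdiv hndiv hne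
  -- the discharged index: `ord_p #Sel_str = n + ord_p #Ш[p^∞]`
  have hI := (StrictSha.strictSelmerIndexAt_holds W p).padicValNat_card_eq hP hgen htors hdiv hndiv
  rw [hI, Nat.cast_add] at hv3
  rw [hsplit, hval, ← hv3]
  push_cast
  ring

/-- **The typed item C-cc-1 at `(W, p)` FROM `BSD(W, p)`** (+ (C3_η) at `(W, p)`, (C1_η) on the good
twins of `W`, and the displayed non-vanishing of `coeff₁` on the data): the converse direction of
p307042's consumer. So, modulo (C1_η) ∧ (C3_η), C-cc-1 at a pair IS Miller's `BSD(W, p)` at that pair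
— the memo's §2a (`HOME/MEMO-bsd-cm-inert.md`): its `L′(W,1)`-content can only come from a
`p`-adic-versus-complex special-value formula. CONDITIONAL; nothing booked; C-cc-1 stays a typed
conjecture item. [cite: Miller2011LMS, §1 and Def. 1.1] [cite: Kobayashi2003, Thm. 7.4 (p. 13)] -/
theorem quadraticBranchPAdicGrossZagierValuationAt_of_bsdp (hmod : hasEntireLFunction_rat)
    (hB : BSDp W p) (h3 : QuadraticBranchOddStrictExactControlOfPlusMCAt W p)
    (h1 : ∀ (V : WeierstrassCurve ℚ) [V.IsElliptic] [V.IsGloballyMinimal] (C : VariableChange ℚ),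
      C • W.quadraticTwist ((-1) ^ (p / 2) * p) = V → V.HasGoodReductionAtPrime p →
      V.frobeniusTrace p = 0 → QuadraticBranchPlusMainConjectureAt V p)
    (hne : ∀ (V : WeierstrassCurve ℚ) [V.IsElliptic] [V.IsGloballyMinimal]
      {N : ℕ} [NeZero N] {f : CuspForm (Gamma0 N) 2},
      IsNewformOf V f → ∀ (ϖ : ℚ) (L : IwasawaAlgebra p), IsQuadraticBranchMinusLFunction f p ϖ L →
      PowerSeries.coeff 1 L ≠ 0) :
    QuadraticBranchPAdicGrossZagierValuationAt W p := by
  intro V _ _ C N _ f hp hC hgood hap hr hf ϖ hϖ L hL htors P n hP hgen hdiv hndiv q hq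
  have hne' : PowerSeries.coeff 1 L ≠ 0 := hne V hf ϖ L hL
  exact ⟨hne', by
    rw [valuation_coeff_one_eq_of_bsdp_of_exactControl W p hmod hB h3 hp hC hgood hap
      (h1 V C hC hgood hap) hf hϖ hL htors hP hgen hdiv hndiv hr hne' q hq, add_zero]⟩

end Converse

end Summit.BirchSwinnertonDyer.Rank1Residual.Additive

end
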